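import Mathlib.NumberTheory.LegendreSymbol.ZModChar
import Mathlib.AlgebraicGeometry.EllipticCurve.Weierstrass
import HarnessLib

/-!
# `Tam(E)` odd and supersingular at `2` force `N_E ≡ ±3 (mod 8)` — the dictionary law, steps (a), (c)
# (cell `b2b-bsdres`, O1 sub-cell `p = 2`; lens-1 GEN 9 packet C, ported by cc-typer-4 GEN 5 as typer item (27))

HONEST FRAMING (run/shared/lean/b2b/bsd-rank1-residual/, verbatim in every file): the goal of the cell is to DELETE
the COMBINATION-SHAPED residual classes of the Birch–Swinnerton-Dyer formula for ALL analytic-rank `≤ 1` elliptic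
curves over `ℚ` — "full BSD formula for every rank `≤ 1` curve in class `C`" assembled STRICTLY from published
theorems — so that the rank-`≤ 1` remainder becomes exactly the CONSTRUCTION-SHAPED classes, which are TYPED
(missing-input `Prop`s), NOT attempted. This is not "finishing BSD". Elementary THEOREMS with every hypothesis
explicit; nothing about a particular curve; step (b) (Kodaira / Tam-odd, typer item (26a)) is a BINDER `hsq`, not
asserted.

CREDIT. This file is the o1 lens-1 GEN 9 packet `HOME/b2b-bsdres-o1-idea-1-g9/lean/G9_TamParityChi8.lean`
(planner-b2b-bsdres-o1-idea-1-g9-0, 2026-08-21T15:01Z; sha16 of the source `0f181c64a84bf01c`), ported verbatim up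
to the imports (`import Mathlib` narrowed), the namespace (`LensOneG9` dropped), one helper docstring and this
paragraph, per the one-writer rule (o1 lead GEN 21 C159 / R-G21.3, typer item (27)).

THE LAW (found while writing the lens-1/lens-4 detector dictionary; census `code/g9_tamparity_scan.py`,
`code/g9_disc_mod8_scan.py` over Cremona's tables, N < 500 000: 226 175 curves with 2 ∤ N supersingular at 2, of
which 50 552 have Tam(E) odd — ALL with N ≡ ±3 (mod 8), 0 exceptions; sign-refined: Δ > 0 ⇒ N ≡ 5 (18 179/18 179),
Δ < 0 ⇒ N ≡ 3 (32 373/32 373)).  PROOF (three steps, the first two typed here):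
* §1 (2-adic) a model with `a₁` even and `a₃` odd — every minimal model with good SUPERSINGULAR reduction at 2
  (`ā₁ = 0` is `j̄ = 0`, then smoothness forces `ā₃ = 1`; census 226 175/226 175) — has `Δ = 8·R + 5` for an explicit
  polynomial `R` (`Δ ≡ −27 b₆² ≡ −3 (mod 8)`): `Δ_eq_eight_mul_add_five`, `Δ_emod_eight`;
* §2 (mod 8) if `N` is odd and `N·|Δ|` is a square then `N ≡ |Δ| (mod 8)`, so `Δ ≡ 5 (mod 8)` gives `N ≡ 5` (`Δ > 0`) or
  `N ≡ 3` (`Δ < 0`), in particular `χ₈(N) = −1`: `emod_eight_of_mul_abs_eq_sq`, `χ₈_eq_neg_one_of_mul_abs_eq_sq`;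
* §3 (Kodaira–Néron, NOT typed here — lens-4 R-SGN2 (i) / refuter v11 §65 'provable now', census 1 218/1 218 and
  here 50 552/50 552) `Tam(E)` odd ⇒ `v_ℓ(N) ≡ v_ℓ(Δ_min) (mod 2)` for every `ℓ` (the odd-`c_ℓ` Kodaira types Iₙ (n odd),
  II, IV, I₀*, IV*, II* have an odd number of components; Ogg–Saito `f = v(Δ) + 1 − m`) ⇒ `N·|Δ_min|` is a square.
CONSEQUENCE FOR THE DICTIONARY: `w(E ⊗ χ₈) = w(E)·χ₈(N)`; on lens-4's Kurihara habitat (Tam odd, r = 0, good ss at 2)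
`w(E ⊗ χ₈) = −1` ALWAYS — the Kurihara door R-KUR2′ lives entirely inside the rank-one-twist (BV2) half of lens-1's
blind-point door R-L1-G7-C, never on its T2 (rank-zero-twist) half, where Tam is even and all Kurihara numbers vanish mod 2.

References: A. P. Ogg, Amer. J. Math. 89 (1967) 1–21 (conductor–discriminant formula); T. Saito, Duke Math. J. 57 (1988);
J. Tate, Algorithm for determining the type of a singular fiber, LNM 476 (1975) (Kodaira table) [Silverman AEC IV §9 Table 4.1].
-/

set_option autoImplicit false

namespace Summit.BirchSwinnertonDyer.Rank1Residual.Supersingular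

/-! ## §1. The discriminant of a model supersingular at 2 is `5 mod 8` -/

/-- For `a₁ = 2s`, `a₃ = 2t + 1`: `Δ = 8·R + 5` with an explicit polynomial `R` (any commutative ring). [folklore] -/
theorem Δ_eq_eight_mul_add_five {R : Type*} [CommRing R] (s t a₂ a₄ a₆ : R) :
    (⟨2 * s, a₂, 2 * t + 1, a₄, a₆⟩ : WeierstrassCurve R).Δ =
      8 * (-2 * (s ^ 2 + a₂) ^ 2 *
              (4 * s ^ 2 * a₆ + 4 * a₂ * a₆ - 2 * s * (2 * t + 1) * a₄ + a₂ * (2 * t + 1) ^ 2 - a₄ ^ 2)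
            - 8 * (a₄ + s * (2 * t + 1)) ^ 3
            + 9 * (s ^ 2 + a₂) * (a₄ + s * (2 * t + 1)) * (4 * (t ^ 2 + t + a₆) + 1)
            - 27 * (2 * (t ^ 2 + t + a₆) ^ 2 + (t ^ 2 + t + a₆)) - 4) + 5 := by
  simp only [WeierstrassCurve.Δ, WeierstrassCurve.b₂, WeierstrassCurve.b₄, WeierstrassCurve.b₆,
    WeierstrassCurve.b₈]
  ring

/-- **`a₁` even and `a₃` odd ⇒ `Δ ≡ 5 (mod 8)`** (integral models; the case of every minimal model with good
supersingular reduction at `2`). [folklore] -/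
theorem Δ_emod_eight (W : WeierstrassCurve ℤ) (h1 : Even W.a₁) (h3 : Odd W.a₃) : W.Δ % 8 = 5 := by
  obtain ⟨a₁, a₂, a₃, a₄, a₆⟩ := W
  obtain ⟨s, hs⟩ := h1
  obtain ⟨t, ht⟩ := h3
  simp only at hs ht
  subst hs ht
  rw [show s + s = 2 * s by ring, Δ_eq_eight_mul_add_five]
  omega

/-! ## §2. `N·|Δ|` a square and `Δ ≡ 5 (mod 8)` force `N ≡ ±3 (mod 8)` -/

/-- In `ℤ/8`: an odd `n` with `n·d` a square and `d ∈ {3, 5}` equals `d`. -/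
private theorem zmod8_key : ∀ n d x : ZMod 8,
    (n = 1 ∨ n = 3 ∨ n = 5 ∨ n = 7) → (d = 5 ∨ d = 3) → n * d = x ^ 2 → n = d := by
  decide

/-- **`N` odd, `Δ ≡ 5 (mod 8)`, `N·|Δ| = m²` ⇒ `N ≡ 5 (mod 8)` if `Δ > 0` and `N ≡ 3 (mod 8)` if `Δ < 0`.** [folklore] -/
theorem emod_eight_of_mul_abs_eq_sq {N Δ m : ℤ} (hN : Odd N) (hΔ : Δ % 8 = 5) (hsq : N * |Δ| = m ^ 2) :
    (0 < Δ → N % 8 = 5) ∧ (Δ < 0 → N % 8 = 3) := by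
  have hN8 : N % 8 = 1 ∨ N % 8 = 3 ∨ N % 8 = 5 ∨ N % 8 = 7 := by obtain ⟨k, hk⟩ := hN; omega
  have hn : (N : ZMod 8) = ((N % 8 : ℤ) : ZMod 8) := by
    simpa using (ZMod.intCast_mod N 8).symm
  have hd : (Δ : ZMod 8) = ((Δ % 8 : ℤ) : ZMod 8) := by
    simpa using (ZMod.intCast_mod Δ 8).symm
  have h8 : (N : ZMod 8) * ((|Δ| : ℤ) : ZMod 8) = ((m : ℤ) : ZMod 8) ^ 2 := by
    have := congrArg (Int.cast : ℤ → ZMod 8) hsq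
    push_cast at this ⊢
    exact this
  have hn' : (N : ZMod 8) = 1 ∨ (N : ZMod 8) = 3 ∨ (N : ZMod 8) = 5 ∨ (N : ZMod 8) = 7 := by
    rw [hn]; rcases hN8 with h | h | h | h <;> rw [h] <;> decide
  refine ⟨fun hpos ↦ ?_, fun hneg ↦ ?_⟩
  · have habs : ((|Δ| : ℤ) : ZMod 8) = 5 := by
      rw [abs_of_pos hpos, hd, hΔ]; decide
    rw [habs] at h8
    have key := zmod8_key _ _ _ hn' (Or.inl rfl) h8
    rw [hn] at key
    rcases hN8 with h | h | h | h <;> rw [h] at key <;> first | exact h | exact absurd key (by decide)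
  · have habs : ((|Δ| : ℤ) : ZMod 8) = 3 := by
      rw [abs_of_neg hneg, Int.cast_neg, hd, hΔ]; decide
    rw [habs] at h8
    have key := zmod8_key _ _ _ hn' (Or.inr rfl) h8
    rw [hn] at key
    rcases hN8 with h | h | h | h <;> rw [h] at key <;> first | exact h | exact absurd key (by decide)

/-- **Corollary: `χ₈(N) = −1`** under the same hypotheses (`Δ ≠ 0`). [folklore] -/
theorem χ₈_eq_neg_one_of_mul_abs_eq_sq {N Δ m : ℤ} (hN : Odd N) (hΔ : Δ % 8 = 5)
    (hsq : N * |Δ| = m ^ 2) : ZMod.χ₈ (N : ZMod 8) = -1 := by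
  have hΔ0 : Δ ≠ 0 := by rintro rfl; norm_num at hΔ
  have h := emod_eight_of_mul_abs_eq_sq hN hΔ hsq
  have hn : (N : ZMod 8) = ((N % 8 : ℤ) : ZMod 8) := by
    simpa using (ZMod.intCast_mod N 8).symm
  rcases lt_or_gt_of_ne hΔ0 with hneg | hpos
  · rw [hn, h.2 hneg]; decide
  · rw [hn, h.1 hpos]; decide

/-- **The law for an integral model** `W` with `a₁` even, `a₃` odd (supersingular at 2), odd `N`, and `N·|Δ_W|` a square
(⇐ `Tam` odd by the Kodaira sign lemma, a BINDER here): `N ≡ 5 (mod 8)` if `Δ_W > 0`, `N ≡ 3 (mod 8)` if `Δ_W < 0`,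
and `χ₈(N) = −1`. [folklore] -/
theorem conductor_emod_eight_of_supersingular_two (W : WeierstrassCurve ℤ) (h1 : Even W.a₁) (h3 : Odd W.a₃)
    {N m : ℤ} (hN : Odd N) (hsq : N * |W.Δ| = m ^ 2) :
    ((0 < W.Δ → N % 8 = 5) ∧ (W.Δ < 0 → N % 8 = 3)) ∧ ZMod.χ₈ (N : ZMod 8) = -1 :=
  ⟨emod_eight_of_mul_abs_eq_sq hN (Δ_emod_eight W h1 h3) hsq,
    χ₈_eq_neg_one_of_mul_abs_eq_sq hN (Δ_emod_eight W h1 h3) hsq⟩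

end Summit.BirchSwinnertonDyer.Rank1Residual.Supersingular
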